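import Summits.BirchSwinnertonDyer.BirchSwinnertonDyer.Theorems.ErratumRoadFiveIMCDivRoadFFFittingFrameBOfThm23
import HarnessLib

/-!
# K2 crux 20169 `IMCDivAtErratumDataAllR`, ROAD FF — the deciding stub from F4♯ RESTRICTED TO THE (dec) LOCUS
# (erratum Thm. 2.3 «⊂» under Lemma 2.1's "`H⁰(K_𝔭̄, A_g[ϖ]) = 0`") + F3♯: the consumer never leaves (dec)
# (helper, `--supports stmt-BirchSwinnertonDyer-25505`)

Cell `bsd-stepL` (run/shared/lean/pub/bsd-stepL/), seat `bsd-stepL-imc-p1` (prover g22, 2026-08-28). Theorems only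
(no definition, no named fact, no `sorry`, no instance, no notation). Memo `HOME/imc-p1/g22/CORNER-25505-imc-p1-g22.md`.

## What this file proves and why

Twin of imc-p1 g15's `ErratumRoadFiveIMCDivRoadFFFittingFrameBOfThm23` (p591580:
`P2.RoadFF.fittingCongruenceFrameAtErratumDataB_of_thm23_OPEN_of_frames (h23 : F4♯) (hL : F3♯) W p`), with the OPEN
input F4♯ (`Castella2018.erratumThm23_charIdeal_sigma_le_of_isTorsion_OPEN`, crux 25505 `ErratumThm23SigmaLe`)
replaced by its RESTRICTION TO THE (dec) LOCUS — the same statement with ONE extra binder after `3 < p`: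

  (dec)  `∀ a : A_g, (∀ σ : Γ_{K_𝔭̄}, σ·a = a) → (∃ j, p^j a = 0) → a = 0`   ("`H⁰(K_𝔭̄, A_g[ϖ]) = 0`", erratum Lemma 2.1),

spelled out below as the hypothesis type of `h23d` (a binder list, NOT a new named fact: it is literally F4♯'s text plus
(dec), and it is PROVED from the two-variable core S1 alone by `ErratumChainDec.erratumThm23SigmaLe_dec_of_twoVarCore`,
file `ErratumRoadFiveErratumThm23DecOfTwoVarCore`).

The point: the consumer applies the fact ONLY at the Hida members `g_m` (`Dm m : HidaCongruentMember W p (max m 1)`)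
of `f_E` on the erratum locus, and there (dec) is a THEOREM of the tree — (iv) `E(ℚ_p)[p] = 0` (`htors`, from the
A′-locus binder), the degree-one embedding `K_𝔭̄ ↪ ℚ_p` (`φ`), and the congruence (b) transported by
`RoadFFMember.forall_fixed_primary_eq_zero_cofreeRepOver` (imc-p1 g9) over `BigRep.hdec_geomPoints_of_padicTorsion`
(imc-p1 g8): the hypothesis `hdecm` below. Every other line is p591580's, byte for byte.

Consequence (file `ErratumRoadFiveClosesOfTwoVarCore`): K2's deciding theorem goes through with binder `h23 : 25505`
replaced by S1 (the registered open core `stub_FW21_twoVarSigmaLePinned` of `Lines/erratum_chain.lean`), i.e. the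
`¬(dec)` corner of the E-free crux 25505 (v3 stub `stub_cornerLocalTorsion`) is OUTSIDE K2's dependency cone.

HONEST FRAMING: CONDITIONAL on the two displayed hypotheses (the (dec)-restricted F4♯ — itself conditional on S1,
OPEN: unrefereed [FW21 4.41] + unprinted weight-`k` CGS restriction — and the published F3♯); nothing is booked; the
anticyclotomic main conjecture is asserted nowhere; BSD is proved for no pair; no census number moves (T7).

References: [Castella2018Erratum] Thm. 1.1 (iv), §2, Lemma 2.1, Thm. 2.3, (2.4)–(2.5), (b), proof of Thm. 1.1 (pp. 1–4);
[FouquetWan2021] Thm. 4.41 (PREPRINT); [Skinner2016PacificMC] §2.6, §3.1; [SkinnerUrban2014] Prop. 3.2.3, Lemma 3.1.9;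
[Castella2020JIMJ] Thm. 2.11; [Castella2018] Thm. 3.1, (3.1), (4.1); [JetchevSkinnerWan2017] §3.4, Cor. 3.4.2, §5.1.
-/

set_option autoImplicit false

noncomputable section

open scoped TensorProduct Classical

open CategoryTheory PowerSeries NumberField IsDedekindDomain Field WeierstrassCurve
open Literature.NumberTheory.GaloisRepresentations Literature.NumberTheory.EllipticCurves
  Literature.NumberTheory.EllipticCurves.BigGaloisRep Literature.NumberTheory.EllipticCurves.GreenbergSelmer
  Literature.NumberTheory.EllipticCurves.Skinner2016 Literature.NumberTheory.EllipticCurves.Rank1Residual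
  Literature.NumberTheory.EllipticCurves.Rank1Residual.Typed Literature.NumberTheory.EllipticCurves.ModularForms
  Literature.NumberTheory.EllipticCurves.Castella2018
open Summit.BirchSwinnertonDyer.Rank1Residual.X11b.Halves Summit.BirchSwinnertonDyer.Rank1Residual.X11b.AcSelmer

namespace Summit.BirchSwinnertonDyer.Rank1Residual.X11b

open RoadFFMember Summit.BirchSwinnertonDyer.BirchSwinnertonDyer.Theorems

/-! ### The deciding stub from the (dec)-restricted F4♯ + F3♯ -/

set_option maxHeartbeats 400000 in
/-- **ROAD FF, THE REGISTERED DECIDING-STUB SIGNATURE of crux `IMCDivAtErratumDataAllR` (item stmt-BirchSwinnertonDyer-20169)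
`∀ W p, P2.RoadFF.FittingCongruenceFrameAtErratumDataB W p Σ(·) P_Σ(·)` from the (dec)-RESTRICTED F4♯ + F3♯** — p591580's assembly
verbatim, with (dec) for every member `g_m` DISCHARGED in the kernel from (iv) `E(ℚ_p)[p] = 0`, `K_𝔭̄ ↪ ℚ_p` and the congruence (b)
(`hdecm`). [cite: Castella2018Erratum, Thm. 1.1 (iv), Lemma 2.1, proof of Thm. 1.1 (pp. 1–4)] -/
theorem P2.RoadFF.fittingCongruenceFrameAtErratumDataB_of_thm23Dec_of_frames
    (h23d :
      ∀ {p : ℕ} [Fact p.Prime] (ι : PadicAlgCl p ≃+* ℂ) {M : ℕ} [NeZero M] {k : ℤ}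
        (g : CuspForm (CongruenceSubgroup.Gamma0 M) k) (ιg : coeffField g →+* PadicAlgCl p)
        (Δ : OrdinaryNewformDatum g p ιg)
        (K : Type) [Field K] [NumberField K] (𝔭 𝔭bar : HeightOneSpectrum (𝓞 K)) (κ : ZpExtension K p)
        (γ : absoluteGaloisGroup K) [Fact (κ.IsTopGenerator γ)] (S : Finset (HeightOneSpectrum (𝓞 K))),
        IsNewform0 g → 2 ≤ k → Even k → 3 ≤ M → ¬ p ∣ M → 3 < p →
        (∀ a : Cofree Δ.ρ (padicCoeffField ιg),
            (∀ σ : LocalGroup K (Sum.inl 𝔭bar), (Δ.cofreeRepOver K) (localMap K (Sum.inl 𝔭bar) σ) a = a) →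
            (∃ j : ℕ, p ^ j • a = 0) → a = 0) →
        (∀ x : coeffField g, ι (ιg x) = (x : ℂ)) →
        ‖ιg ⟨(UpperHalfPlane.qExpansion 1 ⇑g).coeff p, coeff_mem_coeffField g p⟩‖ = 1 →
        IsImaginaryQuadratic K → (∃ β : ℤ, (4 * M : ℤ) ∣ β ^ 2 - NumberField.discr K) →
        ((Ideal.span {(p : ℤ)}).primesOver (𝓞 K)).ncard = 2 →
        ((p : ℕ) : 𝓞 K) ∈ 𝔭.asIdeal →
        (∀ (w : InfinitePlace K) (x : 𝓞 K), x ∈ 𝔭.asIdeal ↔ ‖ι.symm (w.embedding (x : K))‖ < 1) →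
        ((p : ℕ) : 𝓞 K) ∈ 𝔭bar.asIdeal → 𝔭bar ≠ 𝔭 →
        SkinnerUrban2014.IsResiduallyIrreducible Δ →
        (∃ v : HeightOneSpectrum (𝓞 ℚ), SkinnerUrban2014.IsResiduallyRamifiedAt Δ v ∧
          ((Rat.HeightOneSpectrum.primesEquiv v : Nat.Primes) : ℕ) ∣ M ∧
          ¬ ((Rat.HeightOneSpectrum.primesEquiv v : Nat.Primes) : ℕ) ^ 2 ∣ M ∧
          ((Ideal.span {(((Rat.HeightOneSpectrum.primesEquiv v : Nat.Primes) : ℕ) : ℤ)}).primesOver (𝓞 K)).ncard ≠ 2) →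
        (((Ideal.span {(2 : ℤ)}).primesOver (𝓞 K)).ncard ≠ 2 → (2 ∣ M ∧ ¬ 4 ∣ M)) →
        (∀ ℓ : ℕ, ℓ.Prime → ℓ ∣ M → ((Ideal.span {(ℓ : ℤ)}).primesOver (𝓞 K)).ncard ≠ 2 →
          ¬ ℓ ^ 2 ∣ M ∧ (UpperHalfPlane.qExpansion 1 ⇑g).coeff ℓ = -((ℓ : ℂ) ^ (k / 2 - 1).toNat)) →
        κ.IsAnticyclotomic → (∀ w ∈ S, ((p : ℕ) : 𝓞 K) ∉ w.asIdeal) →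
        (∀ w : HeightOneSpectrum (𝓞 K), ((M : ℕ) : 𝓞 K) ∈ w.asIdeal → w ∈ S) →
        ∀ (b : padicCoeffIntegers ιg →+* PadicComplexInt p),
          (∀ x, ((b x : PadicComplexInt p) : ℂ_[p]) =
            algebraMap (PadicAlgCl p) ℂ_[p] (padicCoeffIntegers.toPadicAlgCl ιg x)) →
        ∀ (ΩK : ℂ) (Ωp : (PadicComplexInt p)ˣ) (Q : PowerSeries (PadicComplexInt p)), ΩK ≠ 0 →
          IsBDPLFunctionWtSigmaInt ι 𝔭 κ γ g S ΩK ((Ωp : PadicComplexInt p) : ℂ_[p]) Q →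
        ∀ [TopologicalSpace (PowerSeries (padicCoeffIntegers ιg))]
          [ContinuousSMul (PowerSeries (padicCoeffIntegers ιg))
            (BigRepModule (padicCoeffIntegers ιg) p (Cofree Δ.ρ (padicCoeffField ιg)))],
        Module.IsTorsion (PowerSeries (padicCoeffIntegers ιg)) (XBig κ (Δ.cofreeRepOver K) 𝔭bar (↑S)) →
        (XBig.charIdeal κ (Δ.cofreeRepOver K) 𝔭bar (↑S)).map (PowerSeries.map b) ≤ Ideal.span {Q})
    (hL : erratum_exists_frames_members_sigma_congruence)
    (W : WeierstrassCurve ℚ) [W.IsElliptic] [W.IsGloballyMinimal] (p : ℕ) [Fact p.Prime] :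
    P2.RoadFF.FittingCongruenceFrameAtErratumDataB W p
      (fun K _ _ ↦ (↑(W.sigmaPlacesFinset p K) : Set (HeightOneSpectrum (𝓞 K))))
      (fun K _ _ κ _ ↦ W.sigmaEulerElement p K κ) := by
  intro _ q _ K _ _ Dt H w₀ P hE hr hqp hmq hns hvq hK hCas hP hc hinf κ hκ γ _ ι' e he 𝔭bar h𝔭bar hne
  show P2.RoadFF.FittingCongruenceFrameTwoSlotAt W p κ (primeOfEmbeddingDatum p ι' w₀.embedding) 𝔭bar γ ι'
    Dt.f (↑(W.sigmaPlacesFinset p K) : Set (HeightOneSpectrum (𝓞 K))) (W.sigmaEulerElement p K κ)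
  -- ### the datum's elementary consequences (as in g11's `_of_weak_facts`)
  have hp5 : 5 ≤ p := hE.1
  have hp3 : 3 < p := lt_of_lt_of_le (by norm_num) hp5
  have hmult : Mult W p := hE.2.1
  have hirr : Irr W p := hE.2.2.1
  have htors : ∀ Q : (W.baseChange ℚ_[p]).toAffine.Point, p • Q = 0 → Q = 0 := hE.2.2.2.2
  have hpN : p ∣ W.conductorNorm ℤ := dvd_conductorNorm_of_mult hmult
  have hsplit2 : ((Ideal.span {(p : ℤ)}).primesOver (𝓞 K)).ncard = 2 :=
    hK.ncard_primesOver_eq_two Fact.out hpN hqp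
  have hsp : SplitsIn K p := hK.splitsIn_of_mult hmult (Ne.symm hqp)
  have hHp : SatisfiesHeegnerHypothesis p K := satisfiesHeegnerHypothesis_of_splitsIn Fact.out hsp
  have hHeeg : ∃ β : ℤ, (4 * (W.conductorNorm ℤ) : ℤ) ∣ β ^ 2 - NumberField.discr K :=
    ⟨H.β, H.dvd_sq_sub⟩
  have hnq : ((Ideal.span {(q : ℤ)}).primesOver (𝓞 K)).ncard ≠ 2 :=
    ncard_primesOver_ne_two_of_dvd_discr hK.1.1 Fact.out hK.2.1
  have key : ∀ (ℓ : ℕ) [Fact ℓ.Prime], Mult W ℓ →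
      ((Ideal.span {(ℓ : ℤ)}).primesOver (𝓞 K)).ncard ≠ 2 → ℓ = q := by
    intro ℓ _ hℓ hnsℓ
    by_contra hne'
    exact hnsℓ (hK.2.2.1 ℓ Fact.out (dvd_conductorNorm_of_mult hℓ) hne')
  have hMpos : 0 < W.conductorNorm ℤ / p := hCas.2.2.2.2.2.1
  have hpM : ¬ p ∣ W.conductorNorm ℤ / p := hCas.2.2.2.2.2.2.1
  have hq2 : q ≠ 2 := by
    rintro rfl
    have hodd : Odd (NumberField.discr K) := hCas.2.1
    have h2d : (2 : ℤ) ∣ NumberField.discr K := by exact_mod_cast hK.2.1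
    exact (Int.not_even_iff_odd.mpr hodd) (even_iff_two_dvd.mpr h2d)
  have hqprime : q.Prime := Fact.out
  have hqN : q ∣ W.conductorNorm ℤ := dvd_conductorNorm_of_mult hmq
  have hqM : q ∣ W.conductorNorm ℤ / p := by
    have hqN' := hqN
    rw [← Nat.div_mul_cancel hpN] at hqN'
    exact ((Nat.Coprime.dvd_mul_right ((Nat.coprime_primes hqprime Fact.out).2 hqp)).1 hqN')
  have hM : 3 ≤ W.conductorNorm ℤ / p := by
    have hq3 : 3 ≤ q := by
      rcases hqprime.eq_two_or_odd' with h | h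
      · exact absurd h hq2
      · have := hqprime.two_le; omega
    exact hq3.trans (Nat.le_of_dvd hMpos hqM)
  haveI : NeZero (W.conductorNorm ℤ / p) := ⟨hMpos.ne'⟩
  -- ### `Σ`
  have hSfin : (↑(W.sigmaPlacesFinset p K) : Set (HeightOneSpectrum (𝓞 K))).Finite :=
    (W.sigmaPlacesFinset p K).finite_toSet
  have hSp : ∀ w ∈ (↑(W.sigmaPlacesFinset p K) : Set (HeightOneSpectrum (𝓞 K))),
      ((p : ℕ) : 𝓞 K) ∉ w.asIdeal :=
    fun w hw => W.forall_mem_sigmaPlacesFinset_not_mem p K w (Finset.mem_coe.1 hw)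
  have hS : ∀ w : HeightOneSpectrum (𝓞 K), w ∉ (↑(W.sigmaPlacesFinset p K) : Set (HeightOneSpectrum (𝓞 K))) →
      ((p : ℕ) : 𝓞 K) ∉ w.asIdeal → (W.baseChange K).HasGoodReductionAt w := by
    intro w hw hwp
    rw [WeierstrassCurve.coe_sigmaPlacesFinset] at hw
    exact WeierstrassCurve.hasGoodReductionAt_baseChange_of_not_mem_sigmaPlaces hw hwp
  have hSM : ∀ w : HeightOneSpectrum (𝓞 K), w ∉ (↑(W.sigmaPlacesFinset p K) : Set (HeightOneSpectrum (𝓞 K))) →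
      ((W.conductorNorm ℤ / p : ℕ) : 𝓞 K) ∉ w.asIdeal := by
    intro w hw hM'
    rw [WeierstrassCurve.coe_sigmaPlacesFinset] at hw
    exact hw (WeierstrassCurve.mem_sigmaPlaces_of_tameLevel_mem hpN hpM hM')
  -- ### `K_{𝔭bar} → ℚ_p` (degree one)
  obtain ⟨heb, hfb⟩ := degreeOne_of_splitsIn hK.1.1 hsp h𝔭bar
  obtain ⟨φ⟩ := AcSelmer.exists_ringHom_adicCompletion_padic_of_degreeOne p 𝔭bar h𝔭bar heb hfb
  -- ### F3♯: frames + members, receptacle maps `a = unrToCpInt`, `j = toUnr`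
  obtain ⟨ΩK, Ωp, L, hΩ, hLf, hmem⟩ :=
    hL ι' W K (primeOfEmbeddingDatum p ι' w₀.embedding) κ γ Dt.isNewformOf q rfl hp3 hmult hM hirr hmq hnq hvq
      hK.1 hCas.2.1 hHeeg hsplit2 (natCast_mem_primeOfEmbeddingDatum p ι' w₀.embedding)
      (forall_mem_primeOfEmbeddingDatum_iff p ι' hK.1 w₀) hκ (R1.unrToCpInt p) (toUnr p)
      (R1.coe_unrToCpInt p) (coe_toUnr p)
  choose Dm Qm hDm using fun m : ℕ => hmem (max m 1) (le_max_right m 1)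
  -- the inclusions `b_m : 𝒪_m → 𝓞_{ℂ_p}` (characterised) and their coefficient squares
  choose b hb using fun m : ℕ => exists_ringHom_padicCoeffIntegers_padicComplexInt (Dm m).ι
  -- ### topologies and coefficient-ring instances (as in g11)
  letI : TopologicalSpace (IwasawaAlgebra p) := ⊥
  haveI : DiscreteTopology (IwasawaAlgebra p) := ⟨rfl⟩
  letI τ : ∀ m : ℕ, TopologicalSpace (PowerSeries (padicCoeffIntegers (Dm m).ι)) := fun _ => ⊥
  haveI : ∀ m : ℕ, DiscreteTopology (PowerSeries (padicCoeffIntegers (Dm m).ι)) := fun _ => ⟨rfl⟩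
  haveI : ∀ m : ℕ, IsPrincipalIdealRing (padicCoeffIntegers (Dm m).ι) := fun m =>
    (Dm m).isPrincipalIdealRing_coeffRing
  haveI : ∀ m : ℕ, Module.Free ℤ_[p] (padicCoeffIntegers (Dm m).ι) := fun m => (Dm m).moduleFree_coeffRing
  haveI : ∀ m : ℕ, Module.Finite ℤ_[p] (padicCoeffIntegers (Dm m).ι) := fun m =>
    (Dm m).moduleFinite_coeffRing
  -- finite generation of `X^Σ_ac(A_{g_m})` over `Λ_{𝒪_m}` (SU14 L.3.1.9 is a theorem; T6 + T7 + T8a)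
  haveI : ∀ m : ℕ, Module.Finite (PowerSeries (padicCoeffIntegers (Dm m).ι))
      (XBig κ ((Dm m).Δ.cofreeRepOver K) 𝔭bar (↑(W.sigmaPlacesFinset p K) : Set (HeightOneSpectrum (𝓞 K)))) :=
    fun m =>
      haveI := (Dm m).finiteDimensional_padicCoeffField
      SkinnerUrban2014.moduleFinite_XBig_of_lemma319 SkinnerUrban2014.lemma319_finite_XBig_holds κ 𝔭bar _ hSfin
        ((Dm m).Δ.cofreeRepOver K)
        (GreenbergSelmer.Cofree.exists_pow_psmul_eq_zero (Dm m).ι (Dm m).Δ.ρ)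
        (GreenbergSelmer.Cofree.divisible (padicCoeffField (Dm m).ι) (Dm m).Δ.ρ (Fact.out : p.Prime).ne_zero)
        (GreenbergSelmer.Cofree.finite_setOf_psmul_eq_zero (Dm m).ι (Dm m).Δ.ρ)
        (GreenbergSelmer.OrdinaryNewformDatum.cofreeRepOver_localMap_inr_apply_eq_self (Dm m).Δ K _ hSM)
  -- ### (dec) for every member `g_m`: (iv) `E(ℚ_p)[p] = 0` + `K_𝔭̄ ↪ ℚ_p` + the congruence (b) (erratum Lemma 2.1's input)
  have hdecm : ∀ m : ℕ, ∀ a : Cofree (Dm m).Δ.ρ (padicCoeffField (Dm m).ι),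
      (∀ σ : LocalGroup K (Sum.inl 𝔭bar), ((Dm m).Δ.cofreeRepOver K) (localMap K (Sum.inl 𝔭bar) σ) a = a) →
      (∃ j : ℕ, p ^ j • a = 0) → a = 0 := fun m =>
    RoadFFMember.forall_fixed_primary_eq_zero_cofreeRepOver (Dm m) K (le_max_right m 1)
      (fun σ : absoluteGaloisGroup (𝔭bar.adicCompletion K) => absGaloisRestrict K (𝔭bar.adicCompletion K) σ)
      (BigRep.hdec_geomPoints_of_padicTorsion W p K 𝔭bar φ htors)
  -- ### the member congruences `e_m` (F1 + SelBC + Frob + (b) + Lemma 2.1 — all theorems)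
  have hEm : ∀ m : ℕ, 1 ≤ m →
      Nonempty ((((PowerSeries (padicCoeffIntegers (Dm m).ι)) ⊗[IwasawaAlgebra p]
            AcSelmer.XAc (W.baseChange K) p κ 𝔭bar (↑(W.sigmaPlacesFinset p K) : Set (HeightOneSpectrum (𝓞 K))) γ) ⧸
          (((Ideal.span {(C (p : ℤ_[p]) : IwasawaAlgebra p)}).map
              (algebraMap (IwasawaAlgebra p) (PowerSeries (padicCoeffIntegers (Dm m).ι)))) ^ m •
            (⊤ : Submodule (PowerSeries (padicCoeffIntegers (Dm m).ι))
              ((PowerSeries (padicCoeffIntegers (Dm m).ι)) ⊗[IwasawaAlgebra p]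
                AcSelmer.XAc (W.baseChange K) p κ 𝔭bar (↑(W.sigmaPlacesFinset p K) : Set (HeightOneSpectrum (𝓞 K))) γ))))
          ≃ₗ[PowerSeries (padicCoeffIntegers (Dm m).ι)]
        (XBig κ ((Dm m).Δ.cofreeRepOver K) 𝔭bar (↑(W.sigmaPlacesFinset p K) : Set (HeightOneSpectrum (𝓞 K))) ⧸
          (((Ideal.span {(C (p : ℤ_[p]) : IwasawaAlgebra p)}).map
              (algebraMap (IwasawaAlgebra p) (PowerSeries (padicCoeffIntegers (Dm m).ι)))) ^ m •
            (⊤ : Submodule (PowerSeries (padicCoeffIntegers (Dm m).ι))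
              (XBig κ ((Dm m).Δ.cofreeRepOver K) 𝔭bar (↑(W.sigmaPlacesFinset p K) : Set (HeightOneSpectrum (𝓞 K)))))))) := by
    intro m hm
    exact nonempty_quotPow_congr_of_eq _ (max_eq_left hm)
      (nonempty_memberCongruence_erratum_of_facts SkinnerUrban2014.prop323_XAc_equiv_XBigDecomp_holds
        selmerBig_eq_selmerBigDecomp_of_unramifiedOutside_holds
        Skinner2016.selmerBig_extendScalars_equiv_baseChange_holds hp5 hirr hK.1 hHp 𝔭bar h𝔭bar φ htors _ hSfin
        hSp hS hSM κ hκ γ (Dm m) (le_max_right m 1)).some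
  -- ### (2.5)_m from F4♯ at the member `g_m`, receptacle `𝓞_{ℂ_p}⟦T⟧`
  have hCh : ∀ m : ℕ, 1 ≤ m →
      Module.IsTorsion (PowerSeries (padicCoeffIntegers (Dm m).ι))
          (XBig κ ((Dm m).Δ.cofreeRepOver K) 𝔭bar (↑(W.sigmaPlacesFinset p K) : Set (HeightOneSpectrum (𝓞 K)))) →
        (XBig.charIdeal κ ((Dm m).Δ.cofreeRepOver K) 𝔭bar (↑(W.sigmaPlacesFinset p K) : Set (HeightOneSpectrum (𝓞 K)))).map
          (PowerSeries.map (b m)) ≤ Ideal.span {Qm m} := by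
    intro m _ hT
    obtain ⟨hcompD, hirrD, hramD, hStD, hQ, _⟩ := hDm m
    have hk2 : 2 ≤ (Dm m).k := (Dm m).two_lt_k.le
    have hkeven : Even (Dm m).k := by
      obtain ⟨c, hc⟩ := (Dm m).dvd_k_sub_two
      have hp2 : Even ((p : ℤ) - 1) := by
        have hpodd : Odd p := (Fact.out : p.Prime).odd_of_ne_two (by omega)
        obtain ⟨r, hr⟩ := hpodd
        exact ⟨r, by omega⟩
      have : (Dm m).k = ((p : ℤ) - 1) * c + 2 := by omega
      rw [this]
      exact (hp2.mul_right c).add (by decide)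
    have h2 : ((Ideal.span {(2 : ℤ)}).primesOver (𝓞 K)).ncard ≠ 2 →
        (2 ∣ W.conductorNorm ℤ / p ∧ ¬ 4 ∣ W.conductorNorm ℤ / p) := by
      intro h2ns
      have hmult2 : Mult W 2 := by
        by_cases h2N : 2 ∣ W.conductorNorm ℤ
        · by_cases h2q : (2 : ℕ) = q
          · exact absurd h2q.symm hq2
          · exact absurd (hK.2.2.1 2 Nat.prime_two h2N h2q) h2ns
        · exact absurd (hK.2.2.2.1 h2N) h2ns
      haveI : Fact (Nat.Prime 2) := ⟨Nat.prime_two⟩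
      have hfac : (W.conductorNorm ℤ).factorization 2 = 1 :=
        WeierstrassCurve.factorization_conductorNorm_eq_one_of_hasMultiplicativeReductionAtPrime W 2 hmult2
      have hp2 : p ≠ 2 := by omega
      have hN0 : W.conductorNorm ℤ ≠ 0 := by
        intro h0; rw [h0] at hMpos; simp at hMpos
      have hfacM : (W.conductorNorm ℤ / p).factorization 2 = 1 := by
        rw [Nat.factorization_div hpN, Finsupp.coe_tsub, Pi.sub_apply, hfac,
          Nat.Prime.factorization (Fact.out : p.Prime), Finsupp.single_apply, if_neg hp2, Nat.sub_zero]
      refine ⟨?_, fun h4 => ?_⟩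
      · exact (Nat.Prime.dvd_iff_one_le_factorization Nat.prime_two hMpos.ne').mpr (by omega)
      · have := (Nat.Prime.pow_dvd_iff_le_factorization Nat.prime_two hMpos.ne').mp
          (show 2 ^ 2 ∣ W.conductorNorm ℤ / p by simpa using h4)
        omega
    have hiii : ∀ ℓ : ℕ, ℓ.Prime → ℓ ∣ W.conductorNorm ℤ / p →
        ((Ideal.span {(ℓ : ℤ)}).primesOver (𝓞 K)).ncard ≠ 2 →
          ¬ ℓ ^ 2 ∣ W.conductorNorm ℤ / p ∧
            (UpperHalfPlane.qExpansion 1 ⇑(Dm m).g).coeff ℓ = -((ℓ : ℂ) ^ ((Dm m).k / 2 - 1).toNat) := by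
      intro ℓ hℓ hℓM hℓns
      refine ⟨fun hsq => ?_, hStD ℓ hℓ hℓM hℓns⟩
      have hℓN : ℓ ∣ W.conductorNorm ℤ := hℓM.trans (Nat.div_dvd_of_dvd hpN)
      -- `ℓ` non-split and dividing `N` is `q` (Heegner field: every other prime factor splits), and `q ∥ N`
      have hℓq : ℓ = q := by
        by_contra hne'
        exact hℓns (hK.2.2.1 ℓ hℓ hℓN hne')
      subst hℓq
      have hfac : (W.conductorNorm ℤ).factorization ℓ = 1 :=
        WeierstrassCurve.factorization_conductorNorm_eq_one_of_hasMultiplicativeReductionAtPrime W ℓ hmq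
      have h2le := (Nat.Prime.pow_dvd_iff_le_factorization hℓ (by
        intro h0; rw [h0] at hMpos; simp at hMpos)).mp (hsq.trans (Nat.div_dvd_of_dvd hpN))
      omega
    have hHeegM : ∃ β : ℤ, (4 * (W.conductorNorm ℤ / p : ℕ) : ℤ) ∣ β ^ 2 - NumberField.discr K := by
      obtain ⟨β, hβ⟩ := hHeeg
      refine ⟨β, (dvd_trans ?_ hβ)⟩
      exact mul_dvd_mul_left 4 (Int.natCast_dvd_natCast.mpr (Nat.div_dvd_of_dvd hpN))
    have hram' : ∃ v : HeightOneSpectrum (𝓞 ℚ), SkinnerUrban2014.IsResiduallyRamifiedAt (Dm m).Δ v ∧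
        ((Rat.HeightOneSpectrum.primesEquiv v : Nat.Primes) : ℕ) ∣ W.conductorNorm ℤ / p ∧
        ¬ ((Rat.HeightOneSpectrum.primesEquiv v : Nat.Primes) : ℕ) ^ 2 ∣ W.conductorNorm ℤ / p ∧
        ((Ideal.span {(((Rat.HeightOneSpectrum.primesEquiv v : Nat.Primes) : ℕ) : ℤ)}).primesOver (𝓞 K)).ncard
          ≠ 2 := by
      obtain ⟨v, hvq, hvram⟩ := hramD
      refine ⟨v, hvram, ?_, ?_, ?_⟩
      · rw [hvq]; exact hqM
      · rw [hvq]; exact (hiii q hqprime hqM hnq).1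
      · rw [hvq]; exact hnq
    have hSp' : ∀ w ∈ W.sigmaPlacesFinset p K, ((p : ℕ) : 𝓞 K) ∉ w.asIdeal :=
      fun w hw => W.forall_mem_sigmaPlacesFinset_not_mem p K w hw
    have hSM' : ∀ w : HeightOneSpectrum (𝓞 K), ((W.conductorNorm ℤ / p : ℕ) : 𝓞 K) ∈ w.asIdeal →
        w ∈ W.sigmaPlacesFinset p K := by
      intro w hw
      by_contra hw'
      exact hSM w (by rwa [Finset.mem_coe]) hw
    exact h23d ι' (Dm m).g (Dm m).ι (Dm m).Δ K (primeOfEmbeddingDatum p ι' w₀.embedding) 𝔭bar κ γ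
      (W.sigmaPlacesFinset p K) (Dm m).isNewform hk2 hkeven hM hpM hp3 (hdecm m) hcompD (Dm m).norm_coeff_p hK.1 hHeegM hsplit2
      (natCast_mem_primeOfEmbeddingDatum p ι' w₀.embedding) (forall_mem_primeOfEmbeddingDatum_iff p ι' hK.1 w₀)
      h𝔭bar hne hirrD hram' h2 hiii hκ hSp' hSM' (b m) (hb m) ΩK
      ⟨R1.unrToCpInt p (Ωp : unrIntegers p), R1.unrToCpInt p ((Ωp⁻¹ : (unrIntegers p)ˣ) : unrIntegers p),
        by rw [← map_mul, Units.mul_inv, map_one], by rw [← map_mul, Units.inv_mul, map_one]⟩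
      (Qm m) hΩ hQ hT
  -- ### (c), one-sided, from F3♯'s congruence
  have hc' : ∀ m : ℕ, 1 ≤ m →
      Ideal.span {Qm m} ≤
        Ideal.span {PowerSeries.map (R1.unrToCpInt p) (L * PowerSeries.map (toUnr p) (W.sigmaEulerElement p K κ))} ⊔
          Ideal.span {(PowerSeries.C (((p : ℕ) : 𝓞_ℂ_[p]) ^ m) : PowerSeries 𝓞_ℂ_[p])} := by
    intro m hm
    obtain ⟨_, _, _, _, _, hcong⟩ := hDm m
    rw [max_eq_left hm] at hcong
    exact le_sup_left.trans hcong.le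
  -- ### feed the two-slot Fitting congruence frame through the `𝓞_{ℂ_p}` receptacle
  exact P2.RoadFF.fittingCongruenceFrameTwoSlotAt_of_members_descent_le_cpInt_printed hΩ hLf
    (L * PowerSeries.map (toUnr p) (W.sigmaEulerElement p K κ)) (dvd_refl _) hSfin
    (fun m => PowerSeries (padicCoeffIntegers (Dm m).ι))
    (fun m => PowerSeries.map (b m))
    (fun m => map_comp_algebraMap_eq_of_coe_eq (b m) (hb m))
    (fun m => XBig κ ((Dm m).Δ.cofreeRepOver K) 𝔭bar (↑(W.sigmaPlacesFinset p K) : Set (HeightOneSpectrum (𝓞 K))))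
    Qm (fun m hm => (hEm m hm).some) hCh hc'



end Summit.BirchSwinnertonDyer.Rank1Residual.X11b

end
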